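import Summits.AtomisticToContinuum.BoseEinsteinCondensation.Theorems.BECGroundStateSOSPeriodicIRBoundFsumDCKinetic
import Literature.MathematicalPhysics.QuantumManyBody.PeriodicClusteringFromKyFanGap
import HarnessLib

/-!
# Crux `PeriodicIRBound` (stmt-AtomisticToContinuum-3972), line `fsum-phase-pencil`, stub S5-D1
# `stub_fsumWindowSum` — the weighted window sum

From the `n₀`-weighted class bound `‖U_qΨ‖² + ‖P_qΨ‖² ≤ C N √ρ L/‖q‖_∞` on the window
`0 < ‖q‖_∞ ≤ κ'√ρ L` (`WeightedClassBound`, `U_q = phaseUp = T_{q0} − T_{0,−q}`,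
`P_q = condUp = T_{q0} + T_{0,−q}`, `T_{ab} = transfer L a b`) to the summed bound
`∑_{window} ‖T_{q0}Ψ‖² ≤ 13 C κ'² √ρ N²` for near-minimisers of every class potential:

* kinematics (parallelogram law on the cell): `2‖T_{q0}Ψ‖² ≤ ‖U_qΨ‖² + ‖P_qΨ‖²`, whence
  `‖T_{q0}Ψ‖² ≤ ½ C N √ρ L/‖q‖_∞` in `ℝ≥0∞`;
* the least slack over the finite lattice cube `[-⌊K⌋, ⌊K⌋]³ ⊇ window` (`K = κ'√ρ L`);
* the lattice shell count `∑_{q ∈ [-J, J]³} 1/‖q‖_∞ ≤ 26 J²` (induction on `J`: the shell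
  `[-J-1, J+1]³ ∖ [-J, J]³` has `(2J+3)³ − (2J+1)³ = 24(J+1)² + 2` points of sup norm `J + 1`);
* `ρ L³ = N` (`sideLength_pow_three`).
-/

noncomputable section

open MeasureTheory Filter
open scoped ENNReal NNReal ComplexConjugate BigOperators

namespace Summit.AtomisticToContinuum.BoseEinsteinCondensation.Cruxes.PeriodicIRBound.FsumPhasePencil

open Literature.MathematicalPhysics.QuantumManyBody.BoseGas
open Summit.AtomisticToContinuum.BoseEinsteinCondensation.Theorems.PeriodicIRBound.Negative
  (NearMin InWindow IRBoundFor)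
open Summit.AtomisticToContinuum.BoseEinsteinCondensation.Cruxes.PeriodicIRBound.LinearPhFloorWagner.WF

/-! ## Kinematics: `2‖T_{q0}Ψ‖² ≤ ‖U_qΨ‖² + ‖P_qΨ‖²` -/

section Kinematics

variable {N : ℕ}

/-- `transfer L a b Ψ` is continuous for continuous `Ψ`, in every particle-number sector (it is `0` on the
vacuum sector). [folklore] -/
theorem continuous_transfer_all (L : ℝ) (a b : Fin 3 → ℤ) :
    ∀ {N : ℕ} {Ψ : Config N → ℂ}, Continuous Ψ → Continuous (transfer L a b Ψ)
  | 0, _, _ => continuous_const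
  | _ + 1, _, hΨ => continuous_transfer L a b hΨ

/-- **Kinematics** (parallelogram law on the cell): `2‖T_{q0}Ψ‖² ≤ ‖U_qΨ‖² + ‖P_qΨ‖²` in `ℝ≥0∞`, for a
continuous `Ψ`. [folklore] -/
theorem two_mul_normSq_transfer_le (L : ℝ) (q : Fin 3 → ℤ) {Ψ : Config N → ℂ} (hΨ : Continuous Ψ) :
    2 * normSq L (transfer L q 0 Ψ) ≤ normSq L (phaseUp L q Ψ) + normSq L (condUp L q Ψ) := by
  have h := lintegral_cellN_sq_add_add_sub L (continuous_transfer_all L q 0 hΨ)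
    (continuous_transfer_all L 0 (-q) hΨ)
  calc 2 * normSq L (transfer L q 0 Ψ)
      ≤ 2 * normSq L (transfer L q 0 Ψ) + 2 * normSq L (transfer L 0 (-q) Ψ) := le_self_add
    _ = normSq L (condUp L q Ψ) + normSq L (phaseUp L q Ψ) := h.symm
    _ = normSq L (phaseUp L q Ψ) + normSq L (condUp L q Ψ) := add_comm _ _

/-- From a real bound `‖U_qΨ‖² + ‖P_qΨ‖² ≤ B` to `‖T_{q0}Ψ‖² ≤ B/2` in `ℝ≥0∞`. [folklore] -/
theorem normSq_transfer_le_ofReal_half (L : ℝ) (q : Fin 3 → ℤ) {Ψ : Config N → ℂ} (hΨ : Continuous Ψ)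
    {B : ℝ} (h : (normSq L (phaseUp L q Ψ)).toReal + (normSq L (condUp L q Ψ)).toReal ≤ B) :
    normSq L (transfer L q 0 Ψ) ≤ ENNReal.ofReal (B / 2) := by
  have hT : normSq L (transfer L q 0 Ψ) ≠ ⊤ := normSq_ne_top L (continuous_transfer_all L q 0 hΨ)
  have hU : normSq L (phaseUp L q Ψ) ≠ ⊤ :=
    normSq_ne_top L ((continuous_transfer_all L q 0 hΨ).sub (continuous_transfer_all L 0 (-q) hΨ))
  have hP : normSq L (condUp L q Ψ) ≠ ⊤ :=
    normSq_ne_top L ((continuous_transfer_all L q 0 hΨ).add (continuous_transfer_all L 0 (-q) hΨ))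
  have h2 : 2 * (normSq L (transfer L q 0 Ψ)).toReal ≤
      (normSq L (phaseUp L q Ψ)).toReal + (normSq L (condUp L q Ψ)).toReal := by
    have h' := ENNReal.toReal_mono (ENNReal.add_ne_top.2 ⟨hU, hP⟩) (two_mul_normSq_transfer_le L q hΨ)
    rwa [ENNReal.toReal_mul, ENNReal.toReal_add hU hP, ENNReal.toReal_ofNat] at h'
  have hB : 0 ≤ B := le_trans (add_nonneg ENNReal.toReal_nonneg ENNReal.toReal_nonneg) h
  rw [ENNReal.le_ofReal_iff_toReal_le hT (by linarith)]
  linarith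

end Kinematics

/-! ## The lattice cube `[-J, J]³` and the shell count `∑ 1/‖q‖_∞ ≤ 26 J²` -/

section Lattice

/-- A lattice vector of sup norm `≤ K` lies in the cube `[-⌊K⌋, ⌊K⌋]³`. [folklore] -/
theorem mem_latticeCube_of_norm_le {K : ℝ} {k : Fin 3 → ℤ} (hk : ‖(fun j => (k j : ℝ))‖ ≤ K) :
    k ∈ Fintype.piFinset fun _ : Fin 3 => Finset.Icc (-(⌊K⌋₊ : ℤ)) ⌊K⌋₊ := by
  rw [Fintype.mem_piFinset]
  intro j
  rw [Finset.mem_Icc]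
  have h1 : |(k j : ℝ)| ≤ ‖(fun j => (k j : ℝ))‖ := by
    have := norm_le_pi_norm (fun j => (k j : ℝ)) j
    rwa [Real.norm_eq_abs] at this
  have h2 : ((k j).natAbs : ℝ) ≤ K := by
    rw [Nat.cast_natAbs, Int.cast_abs]
    exact h1.trans hk
  have h3 : (k j).natAbs ≤ ⌊K⌋₊ := Nat.le_floor h2
  constructor <;> omega

/-- `0` lies in every cube `[-J, J]³`. [folklore] -/
theorem zero_mem_latticeCube (J : ℕ) :
    (0 : Fin 3 → ℤ) ∈ Fintype.piFinset fun _ : Fin 3 => Finset.Icc (-(J : ℤ)) J := by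
  rw [Fintype.mem_piFinset]
  intro j
  simp

/-- Outside the cube `[-J, J]³` the sup norm is at least `J + 1`. [folklore] -/
theorem succ_le_norm_of_not_mem_latticeCube {J : ℕ} {q : Fin 3 → ℤ}
    (hq : q ∉ Fintype.piFinset fun _ : Fin 3 => Finset.Icc (-(J : ℤ)) J) :
    (J : ℝ) + 1 ≤ ‖(fun j => (q j : ℝ))‖ := by
  rw [Fintype.mem_piFinset] at hq
  push Not at hq
  obtain ⟨j, hj⟩ := hq
  rw [Finset.mem_Icc, not_and_or, not_le, not_le] at hj
  have h0 : (J : ℤ) + 1 ≤ |q j| := by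
    rcases hj with h | h
    · exact le_abs.2 (Or.inr (by omega))
    · exact le_abs.2 (Or.inl (by omega))
  have h1 : (J : ℝ) + 1 ≤ |(q j : ℝ)| := by
    rw [← Int.cast_abs]
    exact_mod_cast h0
  calc (J : ℝ) + 1 ≤ |(q j : ℝ)| := h1
    _ = ‖(fun j => (q j : ℝ)) j‖ := (Real.norm_eq_abs _).symm
    _ ≤ ‖(fun j => (q j : ℝ))‖ := norm_le_pi_norm (fun j : Fin 3 => (q j : ℝ)) j

/-- The cube `[-J, J]³` has `(2J+1)³` points. [folklore] -/
theorem card_latticeCube (J : ℕ) :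
    (Fintype.piFinset fun _ : Fin 3 => Finset.Icc (-(J : ℤ)) J).card = (2 * J + 1) ^ 3 := by
  rw [Fintype.card_piFinset, Finset.prod_const, Finset.card_univ, Fintype.card_fin, Int.card_Icc]
  congr 1
  omega

/-- The cubes are nested: `[-J, J]³ ⊆ [-J-1, J+1]³`. [folklore] -/
theorem latticeCube_subset_succ (J : ℕ) :
    (Fintype.piFinset fun _ : Fin 3 => Finset.Icc (-(J : ℤ)) J) ⊆
      Fintype.piFinset fun _ : Fin 3 => Finset.Icc (-((J + 1 : ℕ) : ℤ)) (J + 1 : ℕ) := by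
  intro q hq
  rw [Fintype.mem_piFinset] at hq ⊢
  intro j
  have h := hq j
  rw [Finset.mem_Icc] at h ⊢
  push_cast
  omega

/-- **The lattice shell count** `∑_{q ∈ [-J, J]³} 1/‖q‖_∞ ≤ 26 J²` (the term at `q = 0` is `1/0 = 0`):
by induction on `J`, the shell `[-J-1, J+1]³ ∖ [-J, J]³` has `(2J+3)³ − (2J+1)³ = 24(J+1)² + 2` points,
each of sup norm `≥ J + 1`. [folklore] -/
theorem sum_latticeCube_inv_norm_le (J : ℕ) :
    ∑ q ∈ Fintype.piFinset (fun _ : Fin 3 => Finset.Icc (-(J : ℤ)) J), (‖(fun j => (q j : ℝ))‖)⁻¹ ≤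
      26 * (J : ℝ) ^ 2 := by
  induction J with
  | zero =>
    rw [Finset.sum_eq_zero]
    · positivity
    intro q hq
    have hq0 : ∀ j, q j = 0 := fun j => by simpa using (Fintype.mem_piFinset.1 hq) j
    rw [inv_eq_zero, norm_eq_zero]
    funext j
    simp [hq0 j]
  | succ J ih =>
    have hBA := latticeCube_subset_succ J
    rw [← Finset.sum_sdiff hBA]
    have hterm : ∀ q ∈ (Fintype.piFinset fun _ : Fin 3 => Finset.Icc (-((J + 1 : ℕ) : ℤ)) (J + 1 : ℕ)) \
        Fintype.piFinset (fun _ : Fin 3 => Finset.Icc (-(J : ℤ)) J),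
        (‖(fun j => (q j : ℝ))‖)⁻¹ ≤ ((J : ℝ) + 1)⁻¹ := by
      intro q hq
      rw [Finset.mem_sdiff] at hq
      exact inv_anti₀ (by positivity) (succ_le_norm_of_not_mem_latticeCube hq.2)
    have hsum := Finset.sum_le_card_nsmul _ _ _ hterm
    have hcardN := Finset.card_sdiff_add_card_eq_card hBA
    rw [card_latticeCube, card_latticeCube] at hcardN
    have hcard : (((Fintype.piFinset fun _ : Fin 3 => Finset.Icc (-((J + 1 : ℕ) : ℤ)) (J + 1 : ℕ)) \
        Fintype.piFinset (fun _ : Fin 3 => Finset.Icc (-(J : ℤ)) J)).card : ℝ) +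
          (2 * (J : ℝ) + 1) ^ 3 = (2 * ((J : ℝ) + 1) + 1) ^ 3 := by
      exact_mod_cast hcardN
    rw [nsmul_eq_mul] at hsum
    have hJ : (0 : ℝ) ≤ J := Nat.cast_nonneg J
    have key : (((Fintype.piFinset fun _ : Fin 3 => Finset.Icc (-((J + 1 : ℕ) : ℤ)) (J + 1 : ℕ)) \
        Fintype.piFinset (fun _ : Fin 3 => Finset.Icc (-(J : ℤ)) J)).card : ℝ) * ((J : ℝ) + 1)⁻¹ ≤
          24 * ((J : ℝ) + 1) + 2 := by
      rw [← div_eq_mul_inv, div_le_iff₀ (by positivity)]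
      nlinarith [hcard, hJ]
    have e : (26 : ℝ) * ((J + 1 : ℕ) : ℝ) ^ 2 = 26 * ((J : ℝ) + 1) ^ 2 := by push_cast; ring
    rw [e]
    linarith [hsum, key, ih]

end Lattice

/-! ## The window sum at fixed `(N, L)` -/

section Window

variable {N : ℕ}

/-- **The weighted window sum at fixed `(N, L)`**: if `‖U_qΨ‖² + ‖P_qΨ‖² ≤ B/‖q‖_∞` for every window mode
`0 < ‖q‖_∞ ≤ K` (`K ≥ 0`, `B ≥ 0`), then `∑_{window} ‖T_{q0}Ψ‖² ≤ 13 B K²` (in `ℝ≥0∞`; the series is a finite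
sum over the cube `[-⌊K⌋, ⌊K⌋]³`). [folklore] -/
theorem tsum_window_normSq_transfer_le (L : ℝ) {K B : ℝ} (hK : 0 ≤ K) (hB : 0 ≤ B) {Ψ : Config N → ℂ}
    (hΨ : Continuous Ψ)
    (h : ∀ q : Fin 3 → ℤ, q ≠ 0 → ‖(fun j => (q j : ℝ))‖ ≤ K →
      (normSq L (phaseUp L q Ψ)).toReal + (normSq L (condUp L q Ψ)).toReal ≤ B / ‖(fun j => (q j : ℝ))‖) :
    (∑' q : Fin 3 → ℤ, if q ≠ 0 ∧ ‖(fun j => (q j : ℝ))‖ ≤ K then normSq L (transfer L q 0 Ψ) else 0) ≤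
      ENNReal.ofReal (13 * B * K ^ 2) := by
  have hmode : ∀ q : Fin 3 → ℤ,
      (if q ≠ 0 ∧ ‖(fun j => (q j : ℝ))‖ ≤ K then normSq L (transfer L q 0 Ψ) else 0) ≤
        ENNReal.ofReal (B / 2 * (‖(fun j => (q j : ℝ))‖)⁻¹) := by
    intro q
    split_ifs with hq
    · have h' := normSq_transfer_le_ofReal_half L q hΨ (h q hq.1 hq.2)
      rwa [show B / ‖(fun j => (q j : ℝ))‖ / 2 = B / 2 * (‖(fun j => (q j : ℝ))‖)⁻¹ by ring] at h'
    · exact bot_le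
  rw [tsum_eq_sum (s := Fintype.piFinset fun _ : Fin 3 => Finset.Icc (-(⌊K⌋₊ : ℤ)) ⌊K⌋₊)
    (fun q hq => if_neg fun h' => hq (mem_latticeCube_of_norm_le h'.2))]
  calc ∑ q ∈ Fintype.piFinset (fun _ : Fin 3 => Finset.Icc (-(⌊K⌋₊ : ℤ)) ⌊K⌋₊),
        (if q ≠ 0 ∧ ‖(fun j => (q j : ℝ))‖ ≤ K then normSq L (transfer L q 0 Ψ) else 0)
      ≤ ∑ q ∈ Fintype.piFinset (fun _ : Fin 3 => Finset.Icc (-(⌊K⌋₊ : ℤ)) ⌊K⌋₊),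
          ENNReal.ofReal (B / 2 * (‖(fun j => (q j : ℝ))‖)⁻¹) := Finset.sum_le_sum fun q _ => hmode q
    _ = ENNReal.ofReal (∑ q ∈ Fintype.piFinset (fun _ : Fin 3 => Finset.Icc (-(⌊K⌋₊ : ℤ)) ⌊K⌋₊),
          B / 2 * (‖(fun j => (q j : ℝ))‖)⁻¹) :=
        (ENNReal.ofReal_sum_of_nonneg fun q _ => by positivity).symm
    _ ≤ ENNReal.ofReal (13 * B * K ^ 2) := by
        refine ENNReal.ofReal_le_ofReal ?_
        rw [← Finset.mul_sum]
        have hS := sum_latticeCube_inv_norm_le ⌊K⌋₊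
        have hfl : (⌊K⌋₊ : ℝ) ≤ K := Nat.floor_le hK
        have hfl2 : (⌊K⌋₊ : ℝ) ^ 2 ≤ K ^ 2 := pow_le_pow_left₀ (Nat.cast_nonneg _) hfl 2
        calc B / 2 * ∑ q ∈ Fintype.piFinset (fun _ : Fin 3 => Finset.Icc (-(⌊K⌋₊ : ℤ)) ⌊K⌋₊),
              (‖(fun j => (q j : ℝ))‖)⁻¹
            ≤ B / 2 * (26 * K ^ 2) := mul_le_mul_of_nonneg_left (hS.trans (by linarith)) (by positivity)
          _ = 13 * B * K ^ 2 := by ring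

end Window

/-! ## The window sum for the near-minimisers of a class -/

/-- **S5-D1: the weighted window sum.** The weighted class bound on the window `κ'` gives `ρ₀, C` such that
for `ρ < ρ₀`, eventually in `N`, for every class potential with `E₀ ≠ ⊤` there is a slack `δ > 0` (the least of
the per-mode slacks over the finite cube containing the window) with
`∑_{0 < ‖q‖_∞ ≤ κ'√ρL} ‖T_{q0}Ψ‖² ≤ 13 C κ'² √ρ N²` for every `δ`-near-minimiser `Ψ`
(`13 · (C N √ρ L) · (κ'√ρ L)² = 13 C κ'² √ρ N²` by `ρ L³ = N`). [folklore] -/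
theorem windowSum_le_of_weightedClassBound {R₀ V₁ : ℝ} (hW : WeightedClassBound R₀ V₁) {κ' : ℝ}
    (hκ' : 0 < κ') :
    ∃ ρ₀ : ℝ, 0 < ρ₀ ∧ ∃ C : ℝ, 0 < C ∧ ∀ ρ : ℝ, 0 < ρ → ρ < ρ₀ → ∀ᶠ N : ℕ in atTop,
      ∀ w : ℝ → ℝ≥0∞, InClass R₀ V₁ w → periodicGroundStateEnergy w N (sideLength ρ N) ≠ ⊤ →
        ∃ δ : ℝ≥0∞, 0 < δ ∧ ∀ Ψ : PeriodicTrialState N (sideLength ρ N), NearMin w ρ N δ Ψ →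
          (∑' q : Fin 3 → ℤ, if q ≠ 0 ∧ ‖(fun j => (q j : ℝ))‖ ≤ κ' * Real.sqrt ρ * sideLength ρ N then
              normSq (sideLength ρ N) (transfer (sideLength ρ N) q 0 Ψ.ψ) else 0) ≤
            ENNReal.ofReal (13 * C * κ' ^ 2 * Real.sqrt ρ * (N : ℝ) ^ 2) := by
  obtain ⟨ρ₀, hρ₀, C, hC, H⟩ := hW κ' hκ'
  refine ⟨ρ₀, hρ₀, C, hC, fun ρ hρ hρρ₀ => ?_⟩
  filter_upwards [H ρ hρ hρρ₀] with N HN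
  intro w hw hE
  have hL0 : 0 ≤ sideLength ρ N := Real.rpow_nonneg (div_nonneg (Nat.cast_nonneg _) hρ.le) _
  -- a slack for each mode (trivial off the window)
  have hk : ∀ k : Fin 3 → ℤ, ∃ δ : ℝ≥0∞, 0 < δ ∧ (InWindow κ' ρ N k →
      ∀ Ψ : PeriodicTrialState N (sideLength ρ N), NearMin w ρ N δ Ψ →
        (normSq (sideLength ρ N) (phaseUp (sideLength ρ N) k Ψ.ψ)).toReal +
            (normSq (sideLength ρ N) (condUp (sideLength ρ N) k Ψ.ψ)).toReal ≤
          C * N * Real.sqrt ρ * sideLength ρ N / ‖(fun j => (k j : ℝ))‖) := by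
    intro k
    by_cases hkw : InWindow κ' ρ N k
    · obtain ⟨δ, hδ, h⟩ := HN w hw hE k hkw
      exact ⟨δ, hδ, fun _ => h⟩
    · exact ⟨1, one_pos, fun h => (hkw h).elim⟩
  choose δf hδf hprop using hk
  -- the least slack over the finite cube containing the window
  have hWne : (Fintype.piFinset fun _ : Fin 3 =>
      Finset.Icc (-(⌊κ' * Real.sqrt ρ * sideLength ρ N⌋₊ : ℤ)) ⌊κ' * Real.sqrt ρ * sideLength ρ N⌋₊).Nonempty :=
    ⟨0, zero_mem_latticeCube _⟩
  refine ⟨_, (Finset.lt_inf'_iff hWne).2 fun k _ => hδf k, fun Ψ hΨ => ?_⟩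
  have key := tsum_window_normSq_transfer_le (sideLength ρ N) (K := κ' * Real.sqrt ρ * sideLength ρ N)
    (B := C * N * Real.sqrt ρ * sideLength ρ N) (by positivity) (by positivity) Ψ.contDiff.continuous
    (fun q hq0 hqK => hprop q ⟨hq0, hqK⟩ Ψ
      (le_trans hΨ (add_le_add le_rfl (Finset.inf'_le _ (mem_latticeCube_of_norm_le hqK)))))
  refine key.trans (le_of_eq ?_)
  congr 1
  have hL3 : sideLength ρ N ^ 3 = N / ρ := sideLength_pow_three hρ N
  have hsq : Real.sqrt ρ ^ 2 = ρ := Real.sq_sqrt hρ.le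
  calc 13 * (C * N * Real.sqrt ρ * sideLength ρ N) * (κ' * Real.sqrt ρ * sideLength ρ N) ^ 2
      = 13 * C * κ' ^ 2 * Real.sqrt ρ * N * (Real.sqrt ρ ^ 2 * sideLength ρ N ^ 3) := by ring
    _ = 13 * C * κ' ^ 2 * Real.sqrt ρ * (N : ℝ) ^ 2 := by
        rw [hsq, hL3, mul_div_cancel₀ _ hρ.ne']
        ring

/-- **Registered stub `stub_fsumWindowSum`** (line `fsum-phase-pencil`, S5-D1): the weighted window sum
`∑_(window κ') ‖T_(q0)Ψ‖² ≤ 13 C κ'² √ρ N²` from the weighted class bound. [folklore] -/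
theorem stub_fsumWindowSum : (∀ R₀ V₁ : ℝ, 0 < R₀ → 0 ≤ V₁ → WeightedClassBound R₀ V₁ → ∀ κ' : ℝ, 0 < κ' → ∃ ρ₀ : ℝ, 0 < ρ₀ ∧ ∃ C : ℝ, 0 < C ∧ ∀ ρ : ℝ, 0 < ρ → ρ < ρ₀ → ∀ᶠ N : ℕ in atTop, ∀ w : ℝ → ℝ≥0∞, InClass R₀ V₁ w → periodicGroundStateEnergy w N (sideLength ρ N) ≠ ⊤ → ∃ δ : ℝ≥0∞, 0 < δ ∧ ∀ Ψ : PeriodicTrialState N (sideLength ρ N), NearMin w ρ N δ Ψ → (∑' q : Fin 3 → ℤ, if q ≠ 0 ∧ ‖(fun j => (q j : ℝ))‖ ≤ κ' * Real.sqrt ρ * sideLength ρ N then normSq (sideLength ρ N) (transfer (sideLength ρ N) q 0 Ψ.ψ) else 0) ≤ ENNReal.ofReal (13 * C * κ' ^ 2 * Real.sqrt ρ * (N : ℝ) ^ 2)) :=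
  fun _ _ _ _ hW _ hκ' => windowSum_le_of_weightedClassBound hW hκ'

end Summit.AtomisticToContinuum.BoseEinsteinCondensation.Cruxes.PeriodicIRBound.FsumPhasePencil

end
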